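import Literature.MathematicalPhysics.KineticTheory.MetropolisOddStatistic
import HarnessLib

/-!
# Changing the time weight of the Metropolis-odd collision sum costs `sup|Δχ| × ‖g‖‖Ψ‖ ×` the number of terms (line `KineticSlabSketch`, piece P1 of S1a)

Crux `JParityClosure.OddContactSymmetry` (stmt-AtomisticToContinuum-17722, rev 5), line `KineticSlabSketch`, lead
`prover-line-stmt-AtomisticToContinuum-17722-c1-0` (cycle 2).  Piece P1 (time-freezing) of the statics plan for the
registered stub S1a `stub_slabCentring`: the Metropolis-odd mark sees time only through the weight `χ`, the Metropolis
weight lies in `[0, 1]`, so for two weights `χ₁, χ₂` with `|χ₁(t, x) − χ₂(t, x)| ≤ ω` on the window the two collision sums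
over `(0, ℓ]` differ by at most `ω ‖g‖_∞ ‖Ψ‖_∞ ×` the number of ordered contact terms, pathwise on the good set
(`abs_metroOddSum_sub_le`).  Used with `χ₁ = χ(· + s, ·)`, `χ₂ = χ(s, ·)` (frozen at the slab start) and
`ω = ω_χ(K t_N) → 0` (`ℓ ≤ K t_N → 0` as `N → ∞`): the slab sum may be replaced by the sum of a TIME-INDEPENDENT mark, to
which the Campbell formula under the invariant Gibbs law (`integral_collisionPairSum_localGibbsLaw_const`, piece P2)
applies; the expected number of terms is `O(K(N+1))` (`lintegral_collisionPairSum_le_of_le`, piece P5).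
-/

noncomputable section

open scoped BigOperators Classical InnerProductSpace ENNReal Topology
open Set MeasureTheory Filter
open Literature.Analysis.FluidPDE Literature.MathematicalPhysics.KineticTheory

namespace Summit.AtomisticToContinuum.HydrodynamicLimit.Theorems.OddContactSymmetryKineticSlab

/-- The Metropolis-odd mark is affine in the time weight: the difference of the marks for two weights `χ₁, χ₂` is
`(χ₁ − χ₂)(s, xᵢ) · g · (Ψ · min(1, e^{−F}))`. [folklore] -/
theorem metroOddMark_sub_weight {σ : ℝ} {N : ℕ} (χ₁ χ₂ : ℝ × UnitAddTorus (Fin 3) → ℝ) (g : ℝ → ℝ)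
    (Ψ : V3 × V3 × V3 → ℝ) (r ϑ s : ℝ) (z : Config (N + 1) (Fin 3) T3) (i j : Fin (N + 1)) :
    metroOddMark σ N χ₁ g Ψ r ϑ s z i j - metroOddMark σ N χ₂ g Ψ r ϑ s z i j =
      metroOddMark σ N (fun p => χ₁ p - χ₂ p) g Ψ r ϑ s z i j := by
  dsimp only [metroOddMark]
  ring

/-- **Piece P1 (pathwise)**: on the good set, for weights with `|χ₁(t,x) − χ₂(t,x)| ≤ ω` for `t ∈ (0, ℓ]`, `|g| ≤ C_g`,
`|Ψ| ≤ C_Ψ`, the Metropolis-odd collision sums over `(0, ℓ]` differ by at most `ω C_g C_Ψ ×` the number of ordered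
contact terms `collisionPairSum (Ioc 0 ℓ) 1`. [folklore] -/
theorem abs_metroOddSum_sub_le :
    ∀ {σ : ℝ} {N : ℕ} (Φ : HardSphereFlow (Torus.geometry (Fin 3)) (hsDiameter σ N) (N + 1))
    {χ₁ χ₂ : ℝ × UnitAddTorus (Fin 3) → ℝ} {g : ℝ → ℝ} {Ψ : V3 × V3 × V3 → ℝ} {r ϑ ℓ ω Cg CΨ : ℝ}
    (_hω : ∀ t ∈ Ioc (0 : ℝ) ℓ, ∀ x, |χ₁ (t, x) - χ₂ (t, x)| ≤ ω)
    (_hg : ∀ a, |g a| ≤ Cg) (_hΨ : ∀ q, |Ψ q| ≤ CΨ)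
    {z : Config (N + 1) (Fin 3) T3} (_hz : z ∈ Φ.good),
    |metroOddSum σ N Φ (Ioc 0 ℓ) χ₁ g Ψ r ϑ z - metroOddSum σ N Φ (Ioc 0 ℓ) χ₂ g Ψ r ϑ z| ≤
      ω * Cg * CΨ * Φ.collisionPairSum (Ioc 0 ℓ) (fun _ _ _ _ => (1 : ℝ)) z := by
  intro σ N Φ χ₁ χ₂ g Ψ r ϑ ℓ ω Cg CΨ hω hg hΨ z hz
  have hfin := Φ.finite_collisionTimes_inter hz (Ioc_subset_Icc_self : Ioc 0 ℓ ⊆ Icc 0 ℓ)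
  rw [metroOddSum_eq_collisionPairSum_of_mem_good Φ _ hz, metroOddSum_eq_collisionPairSum_of_mem_good Φ _ hz]
  unfold HardSphereFlow.collisionPairSum
  rw [collisionPairSum_eq_finset_sum hfin, collisionPairSum_eq_finset_sum hfin, collisionPairSum_eq_finset_sum hfin,
    ← Finset.sum_sub_distrib, Finset.mul_sum]
  refine (Finset.abs_sum_le_sum_abs _ _).trans (Finset.sum_le_sum fun t ht => ?_)
  rw [← Finset.sum_sub_distrib, Finset.mul_sum]
  refine (Finset.abs_sum_le_sum_abs _ _).trans (Finset.sum_le_sum fun p _ => ?_)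
  have htI : t ∈ Ioc (0 : ℝ) ℓ := (hfin.mem_toFinset.1 ht).2
  rw [metroOddMark_sub_weight, mul_one]
  exact abs_metroOddMark_le (fun q => hω t htI q.2) hg hΨ t _ _ _

end Summit.AtomisticToContinuum.HydrodynamicLimit.Theorems.OddContactSymmetryKineticSlab

end
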